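import Summits.Parity.GeneralizedHardyLittlewood.Theses.LZZCertificateReplay
import Summits.Parity.GeneralizedHardyLittlewood.Theorems.LZZCertificateReplayReplayedCertificatesGlue
import Summits.Parity.GeneralizedHardyLittlewood.Theorems.LZZCertificateReplayLightRows
import Summits.Parity.GeneralizedHardyLittlewood.Theorems.LZZCertificateReplayHeavyRows

/-!
# Split closure of `ReplayedCertificates` (gate-written; R5, gate window 13, 2026-08-30)

Item stmt-Parity-19786 of route route-Parity-LZZCertificateReplay (`Summits.Parity.GeneralizedHardyLittlewood.Theses.LZZCertificateReplay`) was split (gen 1) into 2 children + glue,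
and every child and the glue is closed·proved by an accepted theorem. This module states the derived theorem, so the parent's closer is a
real kernel-checked declaration (rulings 21-frontier F1/F2, 2026-08-30). Do not edit by hand: the gate regenerates it when the family changes.

children: LightRows (stmt-Parity-19293, `Summit.Parity.GeneralizedHardyLittlewood.Theorems.lightRows_holds`); HeavyRows (stmt-Parity-19294, `Summit.Parity.GeneralizedHardyLittlewood.Theorems.heavyRows_holds`)
glue: ReplayedCertificatesGlue (stmt-Parity-19298, `Summit.Parity.GeneralizedHardyLittlewood.Theorems.replayedCertificatesGlue_holds`)
-/

namespace Summit.Parity.GeneralizedHardyLittlewood.Theorems.SplitClosure.LZZCertificateReplay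

/-- `ReplayedCertificates` holds BY SPLIT (gen 1): the glue applied to the proved children. -/
theorem ReplayedCertificates_holds : _root_.Summit.Parity.GeneralizedHardyLittlewood.Theses.LZZCertificateReplay.ReplayedCertificates :=
  (show _root_.Summit.Parity.GeneralizedHardyLittlewood.Theses.LZZCertificateReplay.LightRows → _root_.Summit.Parity.GeneralizedHardyLittlewood.Theses.LZZCertificateReplay.HeavyRows → _root_.Summit.Parity.GeneralizedHardyLittlewood.Theses.LZZCertificateReplay.ReplayedCertificates
    from _root_.Summit.Parity.GeneralizedHardyLittlewood.Theorems.replayedCertificatesGlue_holds)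
    (show _root_.Summit.Parity.GeneralizedHardyLittlewood.Theses.LZZCertificateReplay.LightRows from _root_.Summit.Parity.GeneralizedHardyLittlewood.Theorems.lightRows_holds)
    (show _root_.Summit.Parity.GeneralizedHardyLittlewood.Theses.LZZCertificateReplay.HeavyRows from _root_.Summit.Parity.GeneralizedHardyLittlewood.Theorems.heavyRows_holds)

end Summit.Parity.GeneralizedHardyLittlewood.Theorems.SplitClosure.LZZCertificateReplay
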